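import Mathlib

/-!
# Crux `DrudeDissolution` (stmt-AtomisticToContinuum-12593): the FEJÉR BOUND on the Drude weight
# from a FINITE time window, and its running-Green–Kubo form

Support lemmas for the crux `Summit.AtomisticToContinuum.FouriersLaw.Theses.EmbeddedDrudeMourre.DrudeDissolution`
(line `gram-pencil-harmonic-chaos`, lead c12), in pure measure theory (Mathlib only, no chain objects),
complementing `Theorems/DrudeDissolution/Negative/SpectralPairNecessities.lean` (Wiener–Cesàro limit
`R⁻¹∫₀^R C → σ{0}` and the LOWER bounds `le_atom_of_floor`, `le_atom_of_frequently_cesaro`).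

For a cosine representation `C(t) = ∫ cos(ωt) dσ(ω)` of a finite measure `σ` (the current spectral
measure; `σ{0}` is the DRUDE WEIGHT) and every horizon `R > 0`:

* `integral_fejerWeight_mul_cos`, `integral_fejerWeight'`: the Fejér-weighted cosine integrals
  `∫₀^R (1 − t/R) cos(ωt) dt = (1 − cos(ωR))/(ω²R)` (`ω ≠ 0`), `= R/2` (`ω = 0`);
* `fejerMean_eq_integral`: `2R⁻¹ ∫₀^R (1 − t/R) C(t) dt = ∫ k_R(ω) dσ(ω)` with the Fejér kernel
  `k_R(ω) = 2R⁻¹∫₀^R (1 − t/R)cos(ωt) dt ∈ [0, 1]`, `k_R(0) = 1` (Fubini);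
* `atom_le_fejerMean` / `atom_le_fejerMean'` (**the Fejér bound, an UPPER bound on the atom from ANY finite window**):
  `σ{0} ≤ 2R⁻¹ ∫₀^R (1 − t/R) C(t) dt`;
* `integral_fejerWeight_mul_eq_average_running`: `∫₀^R (1 − t/R) C(t) dt = R⁻¹ ∫₀^R (∫₀^t C) dt`
  (the Fejér mean is the average of the RUNNING Green–Kubo integrals);
* `atom_le_of_running_le` : if `∫₀^t C ≤ A` for all `t ∈ [0, R]` then `σ{0} ≤ 2A/R`;
* `atom_eq_zero_of_running_le`: a running Green–Kubo integral bounded above on `[0, ∞)` forces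
  `σ{0} = 0` (NO DRUDE ATOM) — the converse handle to Mazur's floor.

Use on the crux: the Drude weight of `C_T` is controlled by `C_T` on a FINITE (kinetic) window
`[0, M T⁻²]` alone — so the kinetic-window input (route `KineticCorner`'s `KineticLimit`, stmt-3431,
finite kinetic times) already forces `σ_T{0} = o(T²) = o(C_T(0))`: the harmonic Drude atom dissolves
to leading order WITHOUT any `t = ∞` control; what the crux demands beyond it at fixed `T` (exact
absence of the atom AND a continuous density through `0`) is the post-kinetic content.

Sorry-free; axioms `propext`, `Classical.choice`, `Quot.sound`.
-/

noncomputable section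

namespace Summit.AtomisticToContinuum.FouriersLaw.Theorems.DrudeDissolution

open MeasureTheory Filter Set Topology
open scoped ENNReal

section FejerAtom

variable {C : ℝ → ℝ} {σ : Measure ℝ}

/-- The Fejér weight integrates to `R/2`: `∫₀^R (1 − t/R) dt = R/2`. [folklore] -/
theorem integral_fejerWeight' (R : ℝ) : ∫ t in (0 : ℝ)..R, (1 - t / R) = R / 2 := by
  rw [intervalIntegral.integral_sub intervalIntegrable_const
      (intervalIntegral.intervalIntegrable_id.div_const R),
    intervalIntegral.integral_const, intervalIntegral.integral_div, integral_id]
  rcases eq_or_ne R 0 with rfl | hR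
  · simp
  · field_simp
    ring

/-- The Fejér-weighted cosine integral at a nonzero frequency:
`∫₀^R (1 − t/R) cos(ωt) dt = (1 − cos(ωR)) / (ω² R)` (`ω ≠ 0`, `R ≠ 0`). [folklore] -/
theorem integral_fejerWeight_mul_cos {ω R : ℝ} (hω : ω ≠ 0) (hR : R ≠ 0) :
    ∫ t in (0 : ℝ)..R, (1 - t / R) * Real.cos (ω * t) =
      (1 - Real.cos (ω * R)) / (ω ^ 2 * R) := by
  -- antiderivative `G(t) = sin(ωt)/ω − (t sin(ωt)/ω + cos(ωt)/ω²)/R`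
  have hderiv : ∀ t : ℝ, HasDerivAt
      (fun t : ℝ => Real.sin (ω * t) / ω -
        (t * Real.sin (ω * t) / ω + Real.cos (ω * t) / ω ^ 2) / R)
      ((1 - t / R) * Real.cos (ω * t)) t := by
    intro t
    have hlin : HasDerivAt (fun y : ℝ => ω * y) ω t := by
      simpa using (hasDerivAt_id' t).const_mul ω
    have hs : HasDerivAt (fun y : ℝ => Real.sin (ω * y)) (Real.cos (ω * t) * ω) t := hlin.sin
    have hc : HasDerivAt (fun y : ℝ => Real.cos (ω * y)) (-Real.sin (ω * t) * ω) t := hlin.cos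
    have h1 := hs.div_const ω
    have h2 := (((hasDerivAt_id' t).mul hs).div_const ω).add (hc.div_const (ω ^ 2))
    refine (h1.sub (h2.div_const R)).congr_deriv ?_
    field_simp
    ring
  have hcont : Continuous fun t : ℝ => (1 - t / R) * Real.cos (ω * t) := by fun_prop
  rw [intervalIntegral.integral_eq_sub_of_hasDerivAt (fun t _ => hderiv t)
    (hcont.intervalIntegrable 0 R)]
  simp only [mul_zero, Real.sin_zero, Real.cos_zero, zero_div, zero_add]
  field_simp
  ring

/-! ### The Fejér kernel `k_R(ω) := 2R⁻¹ ∫₀^R (1 − t/R) cos(ωt) dt` (`= (sin(ωR/2)/(ωR/2))²`)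

No definition is introduced (this is a proof file): the kernel is written out at every occurrence;
only `0 ≤ k_R ≤ 1`, `k_R(0) = 1` and continuity are used. -/

/-- `k_R(0) = 1`. -/
theorem fejerKernel_zero {R : ℝ} (hR : R ≠ 0) :
    2 * R⁻¹ * ∫ t in (0 : ℝ)..R, (1 - t / R) * Real.cos (0 * t) = 1 := by
  simp only [zero_mul, Real.cos_zero, mul_one, integral_fejerWeight']
  field_simp

/-- `k_R(ω) = 2(1 − cos(ωR))/(ωR)²` for `ω ≠ 0`. -/
theorem fejerKernel_of_ne_zero {R ω : ℝ} (hR : R ≠ 0) (hω : ω ≠ 0) :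
    2 * R⁻¹ * ∫ t in (0 : ℝ)..R, (1 - t / R) * Real.cos (ω * t) =
      2 * (1 - Real.cos (ω * R)) / (ω * R) ^ 2 := by
  rw [integral_fejerWeight_mul_cos hω hR]
  field_simp

/-- `0 ≤ k_R`. -/
theorem fejerKernel_nonneg {R : ℝ} (hR : R ≠ 0) (ω : ℝ) :
    0 ≤ 2 * R⁻¹ * ∫ t in (0 : ℝ)..R, (1 - t / R) * Real.cos (ω * t) := by
  rcases eq_or_ne ω 0 with rfl | hω
  · rw [fejerKernel_zero hR]; exact zero_le_one
  · rw [fejerKernel_of_ne_zero hR hω]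
    have : 0 ≤ 1 - Real.cos (ω * R) := sub_nonneg.2 (Real.cos_le_one _)
    positivity

/-- `k_R ≤ 1` (from `1 − x²/2 ≤ cos x`). -/
theorem fejerKernel_le_one {R : ℝ} (hR : R ≠ 0) (ω : ℝ) :
    2 * R⁻¹ * ∫ t in (0 : ℝ)..R, (1 - t / R) * Real.cos (ω * t) ≤ 1 := by
  rcases eq_or_ne ω 0 with rfl | hω
  · rw [fejerKernel_zero hR]
  · rw [fejerKernel_of_ne_zero hR hω]
    have hpos : 0 < (ω * R) ^ 2 := by
      have hx : ω * R ≠ 0 := mul_ne_zero hω hR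
      positivity
    rw [div_le_one hpos]
    have := Real.one_sub_sq_div_two_le_cos (x := ω * R)
    nlinarith

/-- `k_R` is continuous in the frequency (a parametric integral of a jointly continuous integrand over
a compact interval). -/
theorem continuous_fejerKernel (R : ℝ) :
    Continuous fun ω : ℝ => 2 * R⁻¹ * ∫ t in (0 : ℝ)..R, (1 - t / R) * Real.cos (ω * t) := by
  refine continuous_const.mul ?_
  have h : Continuous (Function.uncurry fun (ω t : ℝ) => (1 - t / R) * Real.cos (ω * t)) := by
    fun_prop
  exact intervalIntegral.continuous_parametric_intervalIntegral_of_continuous' h 0 R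

/-- **FUBINI FOR THE FEJÉR MEAN.** For `R > 0`,
`2R⁻¹ ∫₀^R (1 − t/R) C(t) dt = ∫ k_R(ω) dσ(ω)`. -/
theorem fejerMean_eq_integral [IsFiniteMeasure σ]
    (hC : ∀ t : ℝ, C t = ∫ ω, Real.cos (ω * t) ∂σ) {R : ℝ} (hR : 0 < R) :
    2 * R⁻¹ * ∫ t in (0 : ℝ)..R, (1 - t / R) * C t =
      ∫ ω, (2 * R⁻¹ * ∫ t in (0 : ℝ)..R, (1 - t / R) * Real.cos (ω * t)) ∂σ := by
  have hCeq : ∀ t, (1 - t / R) * C t = ∫ ω, (1 - t / R) * Real.cos (ω * t) ∂σ := by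
    intro t
    rw [hC t, integral_const_mul]
  simp_rw [hCeq]
  rw [intervalIntegral.integral_of_le hR.le]
  -- Fubini on the finite product `Ioc 0 R × σ`
  have hswap : ∫ t in Ioc (0 : ℝ) R, ∫ ω, (1 - t / R) * Real.cos (ω * t) ∂σ =
      ∫ ω, (∫ t in Ioc (0 : ℝ) R, (1 - t / R) * Real.cos (ω * t)) ∂σ := by
    refine integral_integral_swap (μ := volume.restrict (Ioc (0 : ℝ) R)) (ν := σ)
      (f := fun t ω => (1 - t / R) * Real.cos (ω * t)) ?_
    refine (integrable_const (1 : ℝ)).mono' ?_ ?_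
    · exact Continuous.aestronglyMeasurable (by fun_prop)
    · have hmeas : (volume.restrict (Ioc (0 : ℝ) R)).prod σ =
          (volume.prod σ).restrict (Ioc (0 : ℝ) R ×ˢ (univ : Set ℝ)) := by
        conv_lhs => rw [← Measure.restrict_univ (μ := σ)]
        rw [Measure.prod_restrict]
      rw [hmeas]
      refine (ae_restrict_mem (measurableSet_Ioc.prod MeasurableSet.univ)).mono ?_
      rintro ⟨t, ω⟩ ⟨ht, -⟩
      have h0 : 0 ≤ 1 - t / R := sub_nonneg.2 (div_le_one_of_le₀ ht.2 hR.le)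
      have h1 : 1 - t / R ≤ 1 := by
        have : 0 ≤ t / R := div_nonneg ht.1.le hR.le
        linarith
      simp only [Function.uncurry_apply_pair] at ht ⊢
      rw [norm_mul, Real.norm_eq_abs, Real.norm_eq_abs, abs_of_nonneg h0]
      calc (1 - t / R) * |Real.cos (ω * t)| ≤ 1 * 1 :=
            mul_le_mul h1 (Real.abs_cos_le_one _) (abs_nonneg _) zero_le_one
        _ = 1 := one_mul 1
  rw [hswap]
  simp_rw [intervalIntegral.integral_of_le hR.le]
  rw [integral_const_mul]

/-- **THE FEJÉR BOUND ON THE DRUDE WEIGHT (upper bound from ANY finite window).** If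
`C(t) = ∫ cos(ωt) dσ(ω)` with `σ` finite, then for every `R > 0`
`σ{0} ≤ 2R⁻¹ ∫₀^R (1 − t/R) C(t) dt` — because the right side is `∫ k_R dσ` with `k_R ≥ 0`,
`k_R(0) = 1`. [folklore: Fejér/Wiener] -/
theorem atom_le_fejerMean' [IsFiniteMeasure σ]
    (hC : ∀ t : ℝ, C t = ∫ ω, Real.cos (ω * t) ∂σ) {R : ℝ} (hR : 0 < R) :
    σ.real {0} ≤ 2 * R⁻¹ * ∫ t in (0 : ℝ)..R, (1 - t / R) * C t := by
  rw [fejerMean_eq_integral hC hR]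
  have hind : σ.real {0} = ∫ ω, ({0} : Set ℝ).indicator (fun _ => (1 : ℝ)) ω ∂σ := by
    rw [integral_indicator_const _ (measurableSet_singleton 0), smul_eq_mul, mul_one]
  rw [hind]
  refine integral_mono ?_ ?_ fun ω => ?_
  · exact (integrable_const (1 : ℝ)).indicator (measurableSet_singleton 0)
  · refine (integrable_const (1 : ℝ)).mono' (continuous_fejerKernel R).aestronglyMeasurable
      (Eventually.of_forall fun ω => ?_)
    rw [Real.norm_eq_abs, abs_of_nonneg (fejerKernel_nonneg hR.ne' ω)]
    exact fejerKernel_le_one hR.ne' ω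
  · by_cases hω : ω = 0
    · subst hω
      simp only [mem_singleton_iff, indicator_of_mem]
      exact (fejerKernel_zero hR.ne').symm.le
    · rw [indicator_of_notMem (by simpa using hω)]
      exact fejerKernel_nonneg hR.ne' ω

/-! ### Running-Green–Kubo form and the no-atom criterion -/

/-- **The Fejér mean is the average of the running Green–Kubo integrals**:
`∫₀^R (1 − t/R) C(t) dt = R⁻¹ ∫₀^R (∫₀^t C) dt` for continuous `C` and `R ≠ 0`
(integration by parts: `x ↦ x·∫₀ˣC − ∫₀ˣ sC(s) ds` is a primitive of `x ↦ ∫₀ˣ C`). [folklore] -/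
theorem integral_fejerWeight_mul_eq_average_running (hC : Continuous C) {R : ℝ} (hR : R ≠ 0) :
    ∫ t in (0 : ℝ)..R, (1 - t / R) * C t = R⁻¹ * ∫ t in (0 : ℝ)..R, (∫ s in (0 : ℝ)..t, C s) := by
  have hI : ∀ x : ℝ, HasDerivAt (fun u : ℝ => ∫ s in (0 : ℝ)..u, C s) (C x) x := fun x =>
    (hC.integral_hasStrictDerivAt 0 x).hasDerivAt
  have hc1 : Continuous fun s : ℝ => s * C s := by fun_prop
  have hJ : ∀ x : ℝ, HasDerivAt (fun u : ℝ => ∫ s in (0 : ℝ)..u, s * C s) (x * C x) x := fun x =>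
    (hc1.integral_hasStrictDerivAt 0 x).hasDerivAt
  have hH : ∀ x : ℝ, HasDerivAt
      (fun u : ℝ => u * (∫ s in (0 : ℝ)..u, C s) - ∫ s in (0 : ℝ)..u, s * C s)
      (∫ s in (0 : ℝ)..x, C s) x := by
    intro x
    refine (((hasDerivAt_id' x).mul (hI x)).sub (hJ x)).congr_deriv ?_
    ring
  have hcontI : Continuous fun u : ℝ => ∫ s in (0 : ℝ)..u, C s :=
    intervalIntegral.continuous_primitive (fun a b => hC.intervalIntegrable a b) 0
  rw [intervalIntegral.integral_eq_sub_of_hasDerivAt (fun x _ => hH x)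
    (hcontI.intervalIntegrable 0 R)]
  have hsplit : ∫ t in (0 : ℝ)..R, (1 - t / R) * C t =
      (∫ t in (0 : ℝ)..R, C t) - R⁻¹ * ∫ t in (0 : ℝ)..R, t * C t := by
    have h1 : ∀ t : ℝ, (1 - t / R) * C t = C t - R⁻¹ * (t * C t) := fun t => by ring
    simp_rw [h1]
    have hc2 : Continuous fun t : ℝ => R⁻¹ * (t * C t) := by fun_prop
    rw [intervalIntegral.integral_sub (hC.intervalIntegrable 0 R) (hc2.intervalIntegrable 0 R),
      intervalIntegral.integral_const_mul]
  rw [hsplit]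
  simp only [intervalIntegral.integral_same, mul_zero, sub_zero]
  rw [mul_sub, ← mul_assoc, inv_mul_cancel₀ hR, one_mul]

/-- **ATOM BOUND FROM THE RUNNING GREEN–KUBO INTEGRALS ON A FINITE WINDOW.** If
`C(t) = ∫ cos(ωt) dσ(ω)` (`σ` finite) and `∫₀^t C ≤ A` for all `t ∈ [0, R]` (`R > 0`), then
`σ{0} ≤ 2A/R`. [folklore] -/
theorem atom_le_of_running_le' [IsFiniteMeasure σ]
    (hC : ∀ t : ℝ, C t = ∫ ω, Real.cos (ω * t) ∂σ) {R A : ℝ} (hR : 0 < R)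
    (hA : ∀ t ∈ Icc (0 : ℝ) R, ∫ s in (0 : ℝ)..t, C s ≤ A) :
    σ.real {0} ≤ 2 * A / R := by
  have hcont : Continuous C := by
    have : C = fun t => ∫ ω, Real.cos (ω * t) ∂σ := funext hC
    rw [this]
    refine continuous_of_dominated (bound := fun _ => (1 : ℝ)) ?_ ?_ (integrable_const 1) ?_
    · intro t
      exact (Real.continuous_cos.comp (continuous_id.mul continuous_const)).aestronglyMeasurable
    · intro t
      exact Eventually.of_forall fun ω => by
        rw [Real.norm_eq_abs]; exact Real.abs_cos_le_one _
    · exact Eventually.of_forall fun ω => Real.continuous_cos.comp (continuous_const.mul continuous_id)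
  have hcontI : Continuous fun u : ℝ => ∫ s in (0 : ℝ)..u, C s :=
    intervalIntegral.continuous_primitive (fun a b => hcont.intervalIntegrable a b) 0
  have h1 := atom_le_fejerMean' hC hR
  rw [integral_fejerWeight_mul_eq_average_running hcont hR.ne'] at h1
  have h2 : ∫ t in (0 : ℝ)..R, (∫ s in (0 : ℝ)..t, C s) ≤ ∫ _ in (0 : ℝ)..R, A :=
    intervalIntegral.integral_mono_on hR.le (hcontI.intervalIntegrable 0 R)
      (continuous_const.intervalIntegrable 0 R) fun t ht => hA t ht
  rw [intervalIntegral.integral_const, smul_eq_mul, sub_zero] at h2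
  calc σ.real {0} ≤ 2 * R⁻¹ * (R⁻¹ * ∫ t in (0 : ℝ)..R, ∫ s in (0 : ℝ)..t, C s) := h1
    _ ≤ 2 * R⁻¹ * (R⁻¹ * (R * A)) := by gcongr
    _ = 2 * A / R := by field_simp

/-- **NO DRUDE ATOM FROM A BOUNDED RUNNING GREEN–KUBO INTEGRAL** (the converse handle to Mazur's
floor `Negative.le_atom_of_floor`): if `C(t) = ∫ cos(ωt) dσ(ω)` and `∫₀^t C ≤ A` for all `t ≥ 0`,
then `σ{0} = 0`. In particular a convergent (or merely bounded-above) Green–Kubo integral excludes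
any ballistic component of the current. [folklore] -/
theorem atom_eq_zero_of_running_le' [IsFiniteMeasure σ]
    (hC : ∀ t : ℝ, C t = ∫ ω, Real.cos (ω * t) ∂σ) {A : ℝ}
    (hA : ∀ t : ℝ, 0 ≤ t → ∫ s in (0 : ℝ)..t, C s ≤ A) : σ {0} = 0 := by
  have hle : ∀ R : ℝ, 0 < R → σ.real {0} ≤ 2 * A * R⁻¹ := fun R hR => by
    rw [← div_eq_mul_inv]
    exact atom_le_of_running_le' hC hR fun t ht => hA t ht.1
  have hlim : Tendsto (fun R : ℝ => 2 * A * R⁻¹) atTop (𝓝 0) := by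
    simpa using tendsto_inv_atTop_zero.const_mul (2 * A)
  have h0 : σ.real {0} ≤ 0 :=
    ge_of_tendsto hlim (by
      filter_upwards [eventually_gt_atTop (0 : ℝ)] with R hR using hle R hR)
  have h1 : σ.real {0} = 0 := le_antisymm h0 measureReal_nonneg
  exact (measureReal_eq_zero_iff (measure_ne_top σ _)).1 h1

end FejerAtom

/-! ### Registered forms (sub-goals of stmt-AtomisticToContinuum-12593, headers verbatim) -/

/-- **FEJÉR BOUND ON THE DRUDE WEIGHT** (registered sub-goal `atom_le_fejerMean` of the crux
stmt-AtomisticToContinuum-12593): `σ{0} ≤ 2R⁻¹ ∫₀^R (1 − t/R) C(t) dt` for every `R > 0` whenever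
`C(t) = ∫ cos(ωt) dσ(ω)` with `σ` finite. [folklore: Fejér/Wiener] -/
theorem atom_le_fejerMean : ∀ {C : ℝ → ℝ} {σ : MeasureTheory.Measure ℝ} [MeasureTheory.IsFiniteMeasure σ], (∀ t : ℝ, C t = ∫ ω, Real.cos (ω * t) ∂σ) → ∀ {R : ℝ}, 0 < R → σ.real {0} ≤ 2 * R⁻¹ * ∫ t in (0 : ℝ)..R, (1 - t / R) * C t :=
  fun hC _ hR => atom_le_fejerMean' hC hR

/-- **ATOM BOUND FROM RUNNING GREEN–KUBO INTEGRALS** (registered sub-goal `atom_le_of_running_le`):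
`∫₀^t C ≤ A` on `[0, R]` ⇒ `σ{0} ≤ 2A/R`. [folklore] -/
theorem atom_le_of_running_le : ∀ {C : ℝ → ℝ} {σ : MeasureTheory.Measure ℝ} [MeasureTheory.IsFiniteMeasure σ], (∀ t : ℝ, C t = ∫ ω, Real.cos (ω * t) ∂σ) → ∀ {R A : ℝ}, 0 < R → (∀ t ∈ Set.Icc (0 : ℝ) R, ∫ s in (0 : ℝ)..t, C s ≤ A) → σ.real {0} ≤ 2 * A / R :=
  fun hC _ _ hR hA => atom_le_of_running_le' hC hR hA

/-- **NO DRUDE ATOM FROM A BOUNDED RUNNING GREEN–KUBO INTEGRAL** (registered sub-goal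
`atom_eq_zero_of_running_le`): `∫₀^t C ≤ A` for all `t ≥ 0` ⇒ `σ{0} = 0`. [folklore] -/
theorem atom_eq_zero_of_running_le : ∀ {C : ℝ → ℝ} {σ : MeasureTheory.Measure ℝ} [MeasureTheory.IsFiniteMeasure σ], (∀ t : ℝ, C t = ∫ ω, Real.cos (ω * t) ∂σ) → ∀ {A : ℝ}, (∀ t : ℝ, 0 ≤ t → ∫ s in (0 : ℝ)..t, C s ≤ A) → σ {0} = 0 :=
  fun hC _ hA => atom_eq_zero_of_running_le' hC hA

end Summit.AtomisticToContinuum.FouriersLaw.Theorems.DrudeDissolution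

end
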